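import Summits.BirchSwinnertonDyer.Rank1Residual.X9.ChaUnitCoeffRecordsS4
import HarnessLib

/-!
# Class X9, `p = 5`, rank `0`, `ord₅ #Ш_an = 2`: the `5S4` SHA rows closed with NO descent and NO GRH — Cha upper half + the
# two-engine `μ(𝓛₅(E)) = 0` certificate as lower half (per-pair kernel records, part 2: `272484k1`, `272484k2`, `374544bm1`, `374544bm2`)

HONEST FRAMING (cell `b2b-bsdres-*`, verbatim): the cell deletes COMBINATION-SHAPED residual classes of
the rank-≤1 BSD formula from PUBLISHED theorems only and TYPES the construction-shaped remainder; this
is not "finishing BSD". Class X9 stays TYPED at class level; everything here is PER PAIR; no lane verdict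
is changed; no named fact; nothing is booked by this unit (the lane books, the referee rules).
Unit `b2b-bsdres-x9`, gen 15.

Gen 13's records `X9/ChaDescentRecordsS4{,b}.lean` close the `5S4` SHA rows of the X9 census (`r_an = 0`,
`#Ш_an ∈ {25, 100}`, a two-engine Heegner-index row with `ord₅ [E(K):ℤy_K] ≤ 1`) as UPPER half Cha 2005 (= Miller
2011 Thm. 5.2) + LOWER half an exact `5`-descent `Sel⁵(E) ≠ 0` + Cassels–Tate; for eight of them (`38088v1`,
`464648c1`, `219024bv1/bv2`, `272484k1/k2`, `374544bm1/bm2`) that descent line's class-group step is GRH-conditional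
(degree-24 field, Zimmert bound out of reach) — after referee A's ROUND 197 two are booked LITERAL (`38088v`,
`464648c`) and three 'cell closed, class still residue' (`219024bv`, `272484k`, `374544bm`). HERE the lower half is
replaced by gen 9's GRH-FREE one (`X9/IwasawaLowerBound.lean`, `bsdp_of_cha_of_unitCoeff_of_analyticRank_eq_zero`):
BCS 2025 Thm. 1.1.2 (a) + Greenberg Thm. 4.1 + the period unit + modularity + GZK and ONE finite certificate
`μ(𝓛₅(E)) = 0` give `ord₅ #Ш(E) ≥ ord₅ #Ш_an(E) = 2`; with Cha's `ord₅ #Ш(E) ≤ 2·ord₅ [E(K):ℤy_K] ≤ 2` this is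
`BSD(E,5)`. So each record below has, besides PUBLISHED binders (`hBCS`, `hGr`, `h5`, `hmodP`, `hmodL`, `hGZK`, `hCha`),
only FINITE certificate binders — `r_an = 0`, the Heegner field/point with its two-engine index row (`ord₅ ≤ 1`),
`#Ш_an = q` with `ord₅ q = 2` (Cremona / the cell's engines), and `hcert` = one `5`-adic unit coefficient of
`ϖ·L₅(f_E, α)` (gen 9 `HOME/b2b-bsdres-x9/g9/mu/MU-ALL.tsv`: engines B (PARI-free modular symbols) and C (twisted
`L`-values), `λ = 2` on every row here) — and NO descent, NO class group, NO GRH, NO Jetchev. Galois / CM /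
reduction data DECIDED IN THE KERNEL from the integer model (x11c's `IntModel` toolkit as in gen 13/14:
`j ∉` the thirteen CM values, `5 ∤ Δ` and `#Ẽ(𝔽₅)` (good ORDINARY), gen 13's Frobenius point counts `card_c<label>_ℓ`
(`E[5]` irreducible, Mazur 1978 Prop. 6.3 (1)), Kraus' bounded minimality criterion, `Δ ≠ 0`).

References: B. Cha, J. Number Theory 111 (2005) = Miller 2011 Thm. 5.2 [Miller2011LMS]; Burungale–Castella–Skinner IMRN
2025 Thm. 1.1.2 (a); Greenberg LNM 1716 Thm. 4.1; Mazur 1978 Prop. 6.3 (1); Silverman AEC VII.1; Cremona's tables.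
-/

set_option autoImplicit false

noncomputable section

open scoped Classical MatrixGroups ModularForm

open CongruenceSubgroup WeierstrassCurve Literature.NumberTheory.EllipticCurves
  Literature.NumberTheory.EllipticCurves.ModularForms Literature.NumberTheory.EllipticCurves.Rank1Residual
  Literature.NumberTheory.EllipticCurves.Rank1Residual.Typed
  Literature.NumberTheory.EllipticCurves.Rank1Residual.X11RankOneCertificates
  Summit.BirchSwinnertonDyer.BirchSwinnertonDyer.Rank1Residual.IntModel
  Summit.BirchSwinnertonDyer.BirchSwinnertonDyer.Rank1Residual.X11RankOne
  Summit.BirchSwinnertonDyer.Rank1Residual.X11b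

namespace Summit.BirchSwinnertonDyer.Rank1Residual.X9

/-! ### Kernel data and records -/

/-- `#Ẽ(𝔽₅) = 3` (`a₅ = 3`: good ORDINARY) for Cremona's model `272484k1` (kernel count). [folklore] -/
theorem card_u272484k1_5 :
    Nat.card (((⟨0, 0, 0, 7569, -439002⟩ : WeierstrassCurve ℤ).map
      (Int.castRingHom (ZMod 5))).toAffine.Point) = 3 := by
  rw [@WeierstrassCurve.natCard_point_eq_one_add_card (ZMod 5) (@ZMod.instField 5 ⟨by norm_num⟩) _ _ _
    (by decide +kernel), @card_sol_eq_sum_euler (ZMod 5) (@ZMod.instField 5 ⟨by norm_num⟩) _ _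
    (by rw [ZMod.ringChar_zmod_n]; decide), ZMod.card]
  decide +kernel

/-- `272484k1`'s Cremona model: `Δ ≠ 0` (kernel). [cite: Cremona2006, Table 1 (Cremona label 272484k1)] -/
theorem isElliptic_u272484k1 : (⟨0, 0, 0, 7569, -439002⟩ : WeierstrassCurve ℚ).IsElliptic :=
  isElliptic_of_discOf_ne_zero 0 0 0 7569 (-439002) (by decide +kernel)

/-- `272484k1`'s Cremona model is globally minimal (Kraus' bounded criterion, kernel). [cite: SilvermanAEC2009, VII.1 Remark 1.1] -/
theorem isGloballyMinimal_u272484k1 : (⟨0, 0, 0, 7569, -439002⟩ : WeierstrassCurve ℚ).IsGloballyMinimal :=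
  isGloballyMinimal_of_krausCriterion_bounded₂ 0 0 0 7569 (-439002) (by decide +kernel) (by decide +kernel)
    (by decide +kernel)

/-- **`BSD(E,5)` for `272484k1`, GRH-free** (`N = 272484 = 2²·3⁴·29²`; good ORDINARY at `5`, `a₅ = 3`, `#Ẽ(𝔽₅) = 3`; Cremona model
`[0, 0, 0, 7569, -439002]`; `ρ̄_{E,5}` irreducible (gen 13's Frobenius witness `ℓ = 11`: `#Ẽ(𝔽₁₁) = 6`, `a₁₁ = 6`, root-free mod `5`)
and of EXCEPTIONAL type `5S4` (census datum); non-CM (`j ∉` the CM list, kernel); analytic rank `0`; `#Ш_an = 25` (`ord₅ = 2`); ∏c_ℓ = 1) —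
X9 cell closed (R197.7) but class still residue on an X3 cell (gen-13 record `bsdp_c272484k1`: descent line [GRH]) — UPPER half Cha 2005 with the X9 census Heegner row `D = -23`, `[E(K):ℤy_K] = 10`, `ord₅ = 1` (two engines,
`HOME/b2b-bsdres-x9/g13/fold/fold_g13.routes.tsv`), LOWER half `ord₅ #Ш ≥ 2` from the certificate `μ(𝓛₅(E)) = 0` (gen 9 `MU-ALL.tsv`,
engines B and C, `λ = 2`) through BCS 2025 Thm. 1.1.2 (a) + Greenberg Thm. 4.1 + the period unit + modularity + GZK — NO descent, NO
class group, NO GRH. Kernel-decided: non-CM, good ordinary at `5`, `E[5]` irreducible (`ChaDescentRecordsS4.card_c272484k1_11`), and — via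
`isElliptic_u272484k1` / `isGloballyMinimal_u272484k1` — the instance binders. Binders: PUBLISHED `hBCS`, `hGr`, `h5`, `hmodP`, `hmodL`, `hGZK`, `hCha`;
FINITE: `r_an = 0`, the Heegner datum with `ord₅ [E(K):ℤP] ≤ 1`, `#Ш_an = q` with `ord₅ q = 2`, `hcert`. Per pair; nothing booked.
[cite: Miller2011LMS, Thm. 5.2 and Def. 1.1] [cite: BurungaleCastellaSkinner2025, Thm. 1.1.2 (a) (p. 2 of arXiv:2405.00270v2)]
[cite: Cremona2006, Table 1 (Cremona label 272484k1)] -/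
theorem bsdp_u272484k1
    (hBCS : burungale_castella_skinner_charIdeal_eq_padicLFunction)
    (hGr : greenberg_charValue_rankZero) (h5 : realPeriodRat_eq_unit_mul_plusPeriod)
    (hmodP : nonempty_modularParametrizationData) (hmodL : hasEntireLFunction_rat)
    (hGZK : rank_eq_analyticRank_of_analyticRank_le_one) (hCha : Cha2005.thm52_padicValNat_shaOrder_le)
    (W : WeierstrassCurve ℚ) [W.IsElliptic] [W.IsGloballyMinimal] [Fact (Nat.Prime 5)]
    (hW : W = ⟨0, 0, 0, 7569, -439002⟩) (hr : W.analyticRank = 0)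
    {N : ℕ} [NeZero N] {K : Type} [Field K] [NumberField K] (hK : IsImaginaryQuadratic K)
    (hH : SatisfiesHeegnerHypothesis N K) {P : (W.baseChange K).toAffine.Point}
    (hP : IsHeegnerPoint N W K P) (hnt : ¬ IsOfFinAddOrder P)
    (hpD : ¬ (5 : ℤ) ∣ NumberField.discr K) (hpN : ¬ 5 ^ 2 ∣ N)
    (hI : padicValNat 5 (AddSubgroup.zmultiples P).index ≤ 1)
    {q : ℚ} (hq : shaAn W = (q : ℂ)) (hv : padicValRat 5 q = 2)
    (hcert : ∀ [NeZero (W.conductorNorm ℤ)] (f : CuspForm (Gamma0 (W.conductorNorm ℤ)) 2),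
        IsNewformOf W f → ∀ (ϖ : ℚ), (ϖ : ℝ) * W.realPeriodRat = plusPeriod f →
      ∃ m : ℕ, ‖PowerSeries.coeff m
        (PowerSeries.C (ϖ : ℚ_[5]) * padicLFunction f (unitRoot W 5 : ℚ_[5]))‖ = 1) :
    BSDp W 5 := by
  have hIW : integralModelInt W = ⟨0, 0, 0, 7569, -439002⟩ :=
    integralModelInt_eq_of_map_eq _ (by rw [hW]; ext <;> simp [WeierstrassCurve.map])
  haveI : Fact (Nat.Prime 11) := ⟨by norm_num⟩
  exact bsdp_of_ainvs_of_cha_of_unitCoeff hBCS hGr h5 hmodP hmodL hGZK hCha 0 0 0 7569 (-439002) hIW 5 11 6 3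
    (by norm_num) (by decide +kernel) (by decide +kernel) card_u272484k1_5 (by decide) (by decide) (by decide +kernel)
    card_c272484k1_11 (by decide) hr hK hH hP hnt hpD hpN hI hq hv hcert

/-- `#Ẽ(𝔽₅) = 3` (`a₅ = 3`: good ORDINARY) for Cremona's model `272484k2` (kernel count). [folklore] -/
theorem card_u272484k2_5 :
    Nat.card (((⟨0, 0, 0, -295191, -61899282⟩ : WeierstrassCurve ℤ).map
      (Int.castRingHom (ZMod 5))).toAffine.Point) = 3 := by
  rw [@WeierstrassCurve.natCard_point_eq_one_add_card (ZMod 5) (@ZMod.instField 5 ⟨by norm_num⟩) _ _ _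
    (by decide +kernel), @card_sol_eq_sum_euler (ZMod 5) (@ZMod.instField 5 ⟨by norm_num⟩) _ _
    (by rw [ZMod.ringChar_zmod_n]; decide), ZMod.card]
  decide +kernel

/-- `272484k2`'s Cremona model: `Δ ≠ 0` (kernel). [cite: Cremona2006, Table 1 (Cremona label 272484k2)] -/
theorem isElliptic_u272484k2 : (⟨0, 0, 0, -295191, -61899282⟩ : WeierstrassCurve ℚ).IsElliptic :=
  isElliptic_of_discOf_ne_zero 0 0 0 (-295191) (-61899282) (by decide +kernel)

/-- `272484k2`'s Cremona model is globally minimal (Kraus' bounded criterion, kernel). [cite: SilvermanAEC2009, VII.1 Remark 1.1] -/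
theorem isGloballyMinimal_u272484k2 : (⟨0, 0, 0, -295191, -61899282⟩ : WeierstrassCurve ℚ).IsGloballyMinimal :=
  isGloballyMinimal_of_krausCriterion_bounded₂ 0 0 0 (-295191) (-61899282) (by decide +kernel) (by decide +kernel)
    (by decide +kernel)

/-- **`BSD(E,5)` for `272484k2`, GRH-free** (`N = 272484 = 2²·3⁴·29²`; good ORDINARY at `5`, `a₅ = 3`, `#Ẽ(𝔽₅) = 3`; Cremona model
`[0, 0, 0, -295191, -61899282]`; `ρ̄_{E,5}` irreducible (gen 13's Frobenius witness `ℓ = 11`: `#Ẽ(𝔽₁₁) = 6`, `a₁₁ = 6`, root-free mod `5`)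
and of EXCEPTIONAL type `5S4` (census datum); non-CM (`j ∉` the CM list, kernel); analytic rank `0`; `#Ш_an = 25` (`ord₅ = 2`); ∏c_ℓ = 3) —
3-isogenous to 272484k1 (gen-13 record `bsdp_c272484k2`: descent line [GRH]) — UPPER half Cha 2005 with the X9 census Heegner row `D = -23`, `[E(K):ℤy_K] = 30`, `ord₅ = 1` (two engines,
`HOME/b2b-bsdres-x9/g13/fold/fold_g13.routes.tsv`), LOWER half `ord₅ #Ш ≥ 2` from the certificate `μ(𝓛₅(E)) = 0` (gen 9 `MU-ALL.tsv`,
engines B and C, `λ = 2`) through BCS 2025 Thm. 1.1.2 (a) + Greenberg Thm. 4.1 + the period unit + modularity + GZK — NO descent, NO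
class group, NO GRH. Kernel-decided: non-CM, good ordinary at `5`, `E[5]` irreducible (`ChaDescentRecordsS4.card_c272484k2_11`), and — via
`isElliptic_u272484k2` / `isGloballyMinimal_u272484k2` — the instance binders. Binders: PUBLISHED `hBCS`, `hGr`, `h5`, `hmodP`, `hmodL`, `hGZK`, `hCha`;
FINITE: `r_an = 0`, the Heegner datum with `ord₅ [E(K):ℤP] ≤ 1`, `#Ш_an = q` with `ord₅ q = 2`, `hcert`. Per pair; nothing booked.
[cite: Miller2011LMS, Thm. 5.2 and Def. 1.1] [cite: BurungaleCastellaSkinner2025, Thm. 1.1.2 (a) (p. 2 of arXiv:2405.00270v2)]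
[cite: Cremona2006, Table 1 (Cremona label 272484k2)] -/
theorem bsdp_u272484k2
    (hBCS : burungale_castella_skinner_charIdeal_eq_padicLFunction)
    (hGr : greenberg_charValue_rankZero) (h5 : realPeriodRat_eq_unit_mul_plusPeriod)
    (hmodP : nonempty_modularParametrizationData) (hmodL : hasEntireLFunction_rat)
    (hGZK : rank_eq_analyticRank_of_analyticRank_le_one) (hCha : Cha2005.thm52_padicValNat_shaOrder_le)
    (W : WeierstrassCurve ℚ) [W.IsElliptic] [W.IsGloballyMinimal] [Fact (Nat.Prime 5)]
    (hW : W = ⟨0, 0, 0, -295191, -61899282⟩) (hr : W.analyticRank = 0)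
    {N : ℕ} [NeZero N] {K : Type} [Field K] [NumberField K] (hK : IsImaginaryQuadratic K)
    (hH : SatisfiesHeegnerHypothesis N K) {P : (W.baseChange K).toAffine.Point}
    (hP : IsHeegnerPoint N W K P) (hnt : ¬ IsOfFinAddOrder P)
    (hpD : ¬ (5 : ℤ) ∣ NumberField.discr K) (hpN : ¬ 5 ^ 2 ∣ N)
    (hI : padicValNat 5 (AddSubgroup.zmultiples P).index ≤ 1)
    {q : ℚ} (hq : shaAn W = (q : ℂ)) (hv : padicValRat 5 q = 2)
    (hcert : ∀ [NeZero (W.conductorNorm ℤ)] (f : CuspForm (Gamma0 (W.conductorNorm ℤ)) 2),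
        IsNewformOf W f → ∀ (ϖ : ℚ), (ϖ : ℝ) * W.realPeriodRat = plusPeriod f →
      ∃ m : ℕ, ‖PowerSeries.coeff m
        (PowerSeries.C (ϖ : ℚ_[5]) * padicLFunction f (unitRoot W 5 : ℚ_[5]))‖ = 1) :
    BSDp W 5 := by
  have hIW : integralModelInt W = ⟨0, 0, 0, -295191, -61899282⟩ :=
    integralModelInt_eq_of_map_eq _ (by rw [hW]; ext <;> simp [WeierstrassCurve.map])
  haveI : Fact (Nat.Prime 11) := ⟨by norm_num⟩
  exact bsdp_of_ainvs_of_cha_of_unitCoeff hBCS hGr h5 hmodP hmodL hGZK hCha 0 0 0 (-295191) (-61899282) hIW 5 11 6 3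
    (by norm_num) (by decide +kernel) (by decide +kernel) card_u272484k2_5 (by decide) (by decide) (by decide +kernel)
    card_c272484k2_11 (by decide) hr hK hH hP hnt hpD hpN hI hq hv hcert

/-- `#Ẽ(𝔽₅) = 3` (`a₅ = 3`: good ORDINARY) for Cremona's model `374544bm1` (kernel count). [folklore] -/
theorem card_u374544bm1_5 :
    Nat.card (((⟨0, 0, 0, -11271, -461822⟩ : WeierstrassCurve ℤ).map
      (Int.castRingHom (ZMod 5))).toAffine.Point) = 3 := by
  rw [@WeierstrassCurve.natCard_point_eq_one_add_card (ZMod 5) (@ZMod.instField 5 ⟨by norm_num⟩) _ _ _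
    (by decide +kernel), @card_sol_eq_sum_euler (ZMod 5) (@ZMod.instField 5 ⟨by norm_num⟩) _ _
    (by rw [ZMod.ringChar_zmod_n]; decide), ZMod.card]
  decide +kernel

/-- `374544bm1`'s Cremona model: `Δ ≠ 0` (kernel). [cite: Cremona2006, Table 1 (Cremona label 374544bm1)] -/
theorem isElliptic_u374544bm1 : (⟨0, 0, 0, -11271, -461822⟩ : WeierstrassCurve ℚ).IsElliptic :=
  isElliptic_of_discOf_ne_zero 0 0 0 (-11271) (-461822) (by decide +kernel)

/-- `374544bm1`'s Cremona model is globally minimal (Kraus' bounded criterion, kernel). [cite: SilvermanAEC2009, VII.1 Remark 1.1] -/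
theorem isGloballyMinimal_u374544bm1 : (⟨0, 0, 0, -11271, -461822⟩ : WeierstrassCurve ℚ).IsGloballyMinimal :=
  isGloballyMinimal_of_krausCriterion_bounded₂ 0 0 0 (-11271) (-461822) (by decide +kernel) (by decide +kernel)
    (by decide +kernel)

/-- **`BSD(E,5)` for `374544bm1`, GRH-free** (`N = 374544 = 2⁴·3⁴·17²`; good ORDINARY at `5`, `a₅ = 3`, `#Ẽ(𝔽₅) = 3`; Cremona model
`[0, 0, 0, -11271, -461822]`; `ρ̄_{E,5}` irreducible (gen 13's Frobenius witness `ℓ = 11`: `#Ẽ(𝔽₁₁) = 6`, `a₁₁ = 6`, root-free mod `5`)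
and of EXCEPTIONAL type `5S4` (census datum); non-CM (`j ∉` the CM list, kernel); analytic rank `0`; `#Ш_an = 25` (`ord₅ = 2`); ∏c_ℓ = 1) —
X9 cell closed (R197.7) but class still residue on an X3 cell (gen-13 record `bsdp_c374544bm1`: descent line [GRH]) — UPPER half Cha 2005 with the X9 census Heegner row `D = -47`, `[E(K):ℤy_K] = 10`, `ord₅ = 1` (two engines,
`HOME/b2b-bsdres-x9/g13/fold/fold_g13.routes.tsv`), LOWER half `ord₅ #Ш ≥ 2` from the certificate `μ(𝓛₅(E)) = 0` (gen 9 `MU-ALL.tsv`,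
engines B and C, `λ = 2`) through BCS 2025 Thm. 1.1.2 (a) + Greenberg Thm. 4.1 + the period unit + modularity + GZK — NO descent, NO
class group, NO GRH. Kernel-decided: non-CM, good ordinary at `5`, `E[5]` irreducible (`ChaDescentRecordsS4.card_c374544bm1_11`), and — via
`isElliptic_u374544bm1` / `isGloballyMinimal_u374544bm1` — the instance binders. Binders: PUBLISHED `hBCS`, `hGr`, `h5`, `hmodP`, `hmodL`, `hGZK`, `hCha`;
FINITE: `r_an = 0`, the Heegner datum with `ord₅ [E(K):ℤP] ≤ 1`, `#Ш_an = q` with `ord₅ q = 2`, `hcert`. Per pair; nothing booked.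
[cite: Miller2011LMS, Thm. 5.2 and Def. 1.1] [cite: BurungaleCastellaSkinner2025, Thm. 1.1.2 (a) (p. 2 of arXiv:2405.00270v2)]
[cite: Cremona2006, Table 1 (Cremona label 374544bm1)] -/
theorem bsdp_u374544bm1
    (hBCS : burungale_castella_skinner_charIdeal_eq_padicLFunction)
    (hGr : greenberg_charValue_rankZero) (h5 : realPeriodRat_eq_unit_mul_plusPeriod)
    (hmodP : nonempty_modularParametrizationData) (hmodL : hasEntireLFunction_rat)
    (hGZK : rank_eq_analyticRank_of_analyticRank_le_one) (hCha : Cha2005.thm52_padicValNat_shaOrder_le)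
    (W : WeierstrassCurve ℚ) [W.IsElliptic] [W.IsGloballyMinimal] [Fact (Nat.Prime 5)]
    (hW : W = ⟨0, 0, 0, -11271, -461822⟩) (hr : W.analyticRank = 0)
    {N : ℕ} [NeZero N] {K : Type} [Field K] [NumberField K] (hK : IsImaginaryQuadratic K)
    (hH : SatisfiesHeegnerHypothesis N K) {P : (W.baseChange K).toAffine.Point}
    (hP : IsHeegnerPoint N W K P) (hnt : ¬ IsOfFinAddOrder P)
    (hpD : ¬ (5 : ℤ) ∣ NumberField.discr K) (hpN : ¬ 5 ^ 2 ∣ N)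
    (hI : padicValNat 5 (AddSubgroup.zmultiples P).index ≤ 1)
    {q : ℚ} (hq : shaAn W = (q : ℂ)) (hv : padicValRat 5 q = 2)
    (hcert : ∀ [NeZero (W.conductorNorm ℤ)] (f : CuspForm (Gamma0 (W.conductorNorm ℤ)) 2),
        IsNewformOf W f → ∀ (ϖ : ℚ), (ϖ : ℝ) * W.realPeriodRat = plusPeriod f →
      ∃ m : ℕ, ‖PowerSeries.coeff m
        (PowerSeries.C (ϖ : ℚ_[5]) * padicLFunction f (unitRoot W 5 : ℚ_[5]))‖ = 1) :
    BSDp W 5 := by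
  have hIW : integralModelInt W = ⟨0, 0, 0, -11271, -461822⟩ :=
    integralModelInt_eq_of_map_eq _ (by rw [hW]; ext <;> simp [WeierstrassCurve.map])
  haveI : Fact (Nat.Prime 11) := ⟨by norm_num⟩
  exact bsdp_of_ainvs_of_cha_of_unitCoeff hBCS hGr h5 hmodP hmodL hGZK hCha 0 0 0 (-11271) (-461822) hIW 5 11 6 3
    (by norm_num) (by decide +kernel) (by decide +kernel) card_u374544bm1_5 (by decide) (by decide) (by decide +kernel)
    card_c374544bm1_11 (by decide) hr hK hH hP hnt hpD hpN hI hq hv hcert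

/-- `#Ẽ(𝔽₅) = 3` (`a₅ = 3`: good ORDINARY) for Cremona's model `374544bm2` (kernel count). [folklore] -/
theorem card_u374544bm2_5 :
    Nat.card (((⟨0, 0, 0, 23409, -2387718⟩ : WeierstrassCurve ℤ).map
      (Int.castRingHom (ZMod 5))).toAffine.Point) = 3 := by
  rw [@WeierstrassCurve.natCard_point_eq_one_add_card (ZMod 5) (@ZMod.instField 5 ⟨by norm_num⟩) _ _ _
    (by decide +kernel), @card_sol_eq_sum_euler (ZMod 5) (@ZMod.instField 5 ⟨by norm_num⟩) _ _
    (by rw [ZMod.ringChar_zmod_n]; decide), ZMod.card]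
  decide +kernel

/-- `374544bm2`'s Cremona model: `Δ ≠ 0` (kernel). [cite: Cremona2006, Table 1 (Cremona label 374544bm2)] -/
theorem isElliptic_u374544bm2 : (⟨0, 0, 0, 23409, -2387718⟩ : WeierstrassCurve ℚ).IsElliptic :=
  isElliptic_of_discOf_ne_zero 0 0 0 23409 (-2387718) (by decide +kernel)

/-- `374544bm2`'s Cremona model is globally minimal (Kraus' bounded criterion, kernel). [cite: SilvermanAEC2009, VII.1 Remark 1.1] -/
theorem isGloballyMinimal_u374544bm2 : (⟨0, 0, 0, 23409, -2387718⟩ : WeierstrassCurve ℚ).IsGloballyMinimal :=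
  isGloballyMinimal_of_krausCriterion_bounded₂ 0 0 0 23409 (-2387718) (by decide +kernel) (by decide +kernel)
    (by decide +kernel)

/-- **`BSD(E,5)` for `374544bm2`, GRH-free** (`N = 374544 = 2⁴·3⁴·17²`; good ORDINARY at `5`, `a₅ = 3`, `#Ẽ(𝔽₅) = 3`; Cremona model
`[0, 0, 0, 23409, -2387718]`; `ρ̄_{E,5}` irreducible (gen 13's Frobenius witness `ℓ = 11`: `#Ẽ(𝔽₁₁) = 6`, `a₁₁ = 6`, root-free mod `5`)
and of EXCEPTIONAL type `5S4` (census datum); non-CM (`j ∉` the CM list, kernel); analytic rank `0`; `#Ш_an = 25` (`ord₅ = 2`); ∏c_ℓ = 1) —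
3-isogenous to 374544bm1 (gen-13 record `bsdp_c374544bm2`: descent line [GRH]) — UPPER half Cha 2005 with the X9 census Heegner row `D = -47`, `[E(K):ℤy_K] = 10`, `ord₅ = 1` (two engines,
`HOME/b2b-bsdres-x9/g13/fold/fold_g13.routes.tsv`), LOWER half `ord₅ #Ш ≥ 2` from the certificate `μ(𝓛₅(E)) = 0` (gen 9 `MU-ALL.tsv`,
engines B and C, `λ = 2`) through BCS 2025 Thm. 1.1.2 (a) + Greenberg Thm. 4.1 + the period unit + modularity + GZK — NO descent, NO
class group, NO GRH. Kernel-decided: non-CM, good ordinary at `5`, `E[5]` irreducible (`ChaDescentRecordsS4.card_c374544bm2_11`), and — via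
`isElliptic_u374544bm2` / `isGloballyMinimal_u374544bm2` — the instance binders. Binders: PUBLISHED `hBCS`, `hGr`, `h5`, `hmodP`, `hmodL`, `hGZK`, `hCha`;
FINITE: `r_an = 0`, the Heegner datum with `ord₅ [E(K):ℤP] ≤ 1`, `#Ш_an = q` with `ord₅ q = 2`, `hcert`. Per pair; nothing booked.
[cite: Miller2011LMS, Thm. 5.2 and Def. 1.1] [cite: BurungaleCastellaSkinner2025, Thm. 1.1.2 (a) (p. 2 of arXiv:2405.00270v2)]
[cite: Cremona2006, Table 1 (Cremona label 374544bm2)] -/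
theorem bsdp_u374544bm2
    (hBCS : burungale_castella_skinner_charIdeal_eq_padicLFunction)
    (hGr : greenberg_charValue_rankZero) (h5 : realPeriodRat_eq_unit_mul_plusPeriod)
    (hmodP : nonempty_modularParametrizationData) (hmodL : hasEntireLFunction_rat)
    (hGZK : rank_eq_analyticRank_of_analyticRank_le_one) (hCha : Cha2005.thm52_padicValNat_shaOrder_le)
    (W : WeierstrassCurve ℚ) [W.IsElliptic] [W.IsGloballyMinimal] [Fact (Nat.Prime 5)]
    (hW : W = ⟨0, 0, 0, 23409, -2387718⟩) (hr : W.analyticRank = 0)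
    {N : ℕ} [NeZero N] {K : Type} [Field K] [NumberField K] (hK : IsImaginaryQuadratic K)
    (hH : SatisfiesHeegnerHypothesis N K) {P : (W.baseChange K).toAffine.Point}
    (hP : IsHeegnerPoint N W K P) (hnt : ¬ IsOfFinAddOrder P)
    (hpD : ¬ (5 : ℤ) ∣ NumberField.discr K) (hpN : ¬ 5 ^ 2 ∣ N)
    (hI : padicValNat 5 (AddSubgroup.zmultiples P).index ≤ 1)
    {q : ℚ} (hq : shaAn W = (q : ℂ)) (hv : padicValRat 5 q = 2)
    (hcert : ∀ [NeZero (W.conductorNorm ℤ)] (f : CuspForm (Gamma0 (W.conductorNorm ℤ)) 2),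
        IsNewformOf W f → ∀ (ϖ : ℚ), (ϖ : ℝ) * W.realPeriodRat = plusPeriod f →
      ∃ m : ℕ, ‖PowerSeries.coeff m
        (PowerSeries.C (ϖ : ℚ_[5]) * padicLFunction f (unitRoot W 5 : ℚ_[5]))‖ = 1) :
    BSDp W 5 := by
  have hIW : integralModelInt W = ⟨0, 0, 0, 23409, -2387718⟩ :=
    integralModelInt_eq_of_map_eq _ (by rw [hW]; ext <;> simp [WeierstrassCurve.map])
  haveI : Fact (Nat.Prime 11) := ⟨by norm_num⟩
  exact bsdp_of_ainvs_of_cha_of_unitCoeff hBCS hGr h5 hmodP hmodL hGZK hCha 0 0 0 23409 (-2387718) hIW 5 11 6 3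
    (by norm_num) (by decide +kernel) (by decide +kernel) card_u374544bm2_5 (by decide) (by decide) (by decide +kernel)
    card_c374544bm2_11 (by decide) hr hK hH hP hnt hpD hpN hI hq hv hcert

end Summit.BirchSwinnertonDyer.Rank1Residual.X9

end
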